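import Summits.BirchSwinnertonDyer.Rank1Residual.X2.IsogenySelmerSha
import Summits.BirchSwinnertonDyer.Rank1Residual.X2.IsogenySelmerCertificate
import HarnessLib

/-!
# The isogeny on `K`-rational points and the `K`-rational form of
# `#Sel^{(φ)}(E/K) = #(E'(K)/φ(E(K))) · #Ш(E/K)[φ]` (Silverman X.4.2(a))
# (cell `b2b-bsdres`, unit `b2b-bsdres-eisenstein-p2`, gen 25; sequel of `X2/IsogenySelmerSha.lean`)

HONEST FRAMING (run/shared/lean/b2b/bsd-rank1-residual/, verbatim in every file): the goal of the
cell is to DELETE the COMBINATION-SHAPED residual classes of the Birch–Swinnerton-Dyer formula for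
ALL analytic-rank `≤ 1` elliptic curves over `ℚ` — "full BSD formula for every rank `≤ 1` curve in
class `C`" assembled STRICTLY from published theorems — so that the rank-`≤ 1` remainder becomes
exactly the CONSTRUCTION-SHAPED classes, which are TYPED (missing-input `Prop`s), NOT attempted.
This is not "finishing BSD". Research route; NO CLAIM BEYOND STATED CLASSES; nothing here changes a
label; nothing is booked. One definition with body + theorems; no named fact.

WHAT. Gen 24's `X2/IsogenySelmerGroup.lean` / `X2/IsogenySelmerSha.lean` state the fundamental
sequence of a `K`-isogeny `φ : E → E'` (Silverman X.4.2(a)) with the cokernel of `φ` taken on the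
`Γ_K`-INVARIANTS of the geometric points, `E'(K̄)^{Γ_K}/φ(E(K̄)^{Γ_K})` — the shape the generic
connecting homomorphism delivers. The tree's `Isogeny` acts on geometric points only; this file
defines the induced homomorphism on `K`-RATIONAL points (Galois descent `E(K) = E(K̄)^{Γ_K}` for a
perfect field, `IsogenySelmerCertificate.range_toGeomPoints_eq_invariants`) and rewrites the
counting statements in the form a descent engine computes:
* `ratPointsEquivInvariants W : E(K) ≃+ E(K̄)^{Γ_K}` (`toGeomPoints`, corestricted);
* **`ratPointMap φ : E(K) →+ E'(K)`** — the isogeny on `K`-points, with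
  `toGeomPoints_ratPointMap : ι(φ_K P) = φ(ι P)`;
* `map_qInvariants_eq_range_ratPointMap` — under the descent isomorphism, `φ(E(K̄)^Γ) ≤ E'(K̄)^Γ`
  corresponds to `φ_K(E(K)) ≤ E'(K)`; `quotInvariantsEquiv : E'(K̄)^Γ/φ(E(K̄)^Γ) ≃+ E'(K)/φ_K(E(K))`;
* **`natCard_isogenySelmerGroup_eq_mul_natCard_shaKer_rat`**:
  `#Sel^{(φ)}(E/K) = #(E'(K)/φ_K(E(K))) · #Ш(E/K)[φ]` (number field `K`);
* `pow_dvd_shaOrder_of_card_isogenySelmerGroup_rat` (`#Sel^{(φ)} = p^s`, `#(E'(K)/φ_K E(K)) = p^t`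
  ⇒ `p^{s−t} ∣ #Ш(E/K)`) and `natCard_shaKer_eq_one_of_card_eq_rat` (no excess ⇒ `Ш(E/K)[φ]`
  trivial) — the LOWER and UPPER certificate readings with `K`-rational data.

References: Silverman, *AEC*, VIII.§1 (Galois descent), X.4.1–X.4.2(a).
-/

noncomputable section

open scoped Classical

universe u

namespace Summit.BirchSwinnertonDyer.Rank1Residual.X2.IsogenySelmerRational

open WeierstrassCurve Literature.NumberTheory.EllipticCurves
  Summit.BirchSwinnertonDyer.Rank1Residual.X2.TorsionComparison
  Summit.BirchSwinnertonDyer.Rank1Residual.X2.ConnectingHomomorphism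
  Summit.BirchSwinnertonDyer.Rank1Residual.X2.IsogenySelmerGroup
  Summit.BirchSwinnertonDyer.Rank1Residual.X2.IsogenySelmerSha
  Summit.BirchSwinnertonDyer.Rank1Residual.X2.IsogenySelmerCertificate

variable {K : Type u} [Field K] [PerfectField K]

/-! ## §1. Galois descent as an isomorphism `E(K) ≃ E(K̄)^{Γ_K}` -/

section Descent

variable (W : WeierstrassCurve K)

/-- **`E(K) ≃+ E(K̄)^{Γ_K}`** (perfect `K`): `toGeomPoints` is injective with image the
`Γ_K`-invariants (`range_toGeomPoints_eq_invariants`). Silverman, *AEC*, VIII.§1. [folklore] -/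
def ratPointsEquivInvariants :
    W.toAffine.Point ≃+ invariants (Field.absoluteGaloisGroup K) W.geomPoints :=
  (AddMonoidHom.ofInjective (toGeomPoints_injective W)).trans
    (AddEquiv.addSubgroupCongr (range_toGeomPoints_eq_invariants W))

/-- The descent isomorphism is `toGeomPoints` on underlying points. [folklore] -/
@[simp]
theorem coe_ratPointsEquivInvariants (P : W.toAffine.Point) :
    ((ratPointsEquivInvariants W P : invariants (Field.absoluteGaloisGroup K) W.geomPoints) :
      W.geomPoints) = toGeomPoints W P :=
  rfl

/-- The inverse of the descent isomorphism: `toGeomPoints (e⁻¹ Q) = Q`. [folklore] -/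
theorem toGeomPoints_ratPointsEquivInvariants_symm
    (Q : invariants (Field.absoluteGaloisGroup K) W.geomPoints) :
    toGeomPoints W ((ratPointsEquivInvariants W).symm Q) = (Q : W.geomPoints) := by
  have h := coe_ratPointsEquivInvariants W ((ratPointsEquivInvariants W).symm Q)
  rw [AddEquiv.apply_symm_apply] at h
  exact h.symm

end Descent

/-! ## §2. The isogeny on `K`-rational points -/

section RatPointMap

variable {W W' : WeierstrassCurve K}

/-- **The isogeny on `K`-rational points, `φ_K : E(K) →+ E'(K)`**: transport of
`φ|_{E(K̄)^Γ} : E(K̄)^{Γ_K} → E'(K̄)^{Γ_K}` (`qOnInvariants`, well defined by the `Γ_K`-equivariance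
of `φ`) along the descent isomorphisms. Silverman, *AEC*, III.4 (an isogeny defined over `K`
maps `E(K)` to `E'(K)`), VIII.§1. [folklore] -/
def ratPointMap (φ : Isogeny W W') : W.toAffine.Point →+ W'.toAffine.Point :=
  (ratPointsEquivInvariants W').symm.toAddMonoidHom.comp
    ((qOnInvariants (Field.absoluteGaloisGroup K) (q := φ.toAddMonoidHom) (isogeny_smul φ)).comp
      (ratPointsEquivInvariants W).toAddMonoidHom)

/-- **`ι(φ_K P) = φ(ι P)`**: on geometric points `φ_K` is `φ`. [folklore] -/
theorem toGeomPoints_ratPointMap (φ : Isogeny W W') (P : W.toAffine.Point) :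
    toGeomPoints W' (ratPointMap φ P) = φ (toGeomPoints W P) := by
  rw [ratPointMap, AddMonoidHom.comp_apply, AddMonoidHom.comp_apply,
    AddEquiv.coe_toAddMonoidHom, AddEquiv.coe_toAddMonoidHom,
    toGeomPoints_ratPointsEquivInvariants_symm]
  rfl

/-- Under the descent isomorphism of `E'`, `φ(E(K̄)^{Γ_K})` is carried onto `φ_K(E(K))`.
[folklore] -/
theorem map_qInvariants_eq_range_ratPointMap (φ : Isogeny W W') :
    (qInvariants (Field.absoluteGaloisGroup K) (q := φ.toAddMonoidHom) (isogeny_smul φ)).map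
        (ratPointsEquivInvariants W').symm.toAddMonoidHom =
      (ratPointMap φ).range := by
  have htop : (ratPointsEquivInvariants W).toAddMonoidHom.range = ⊤ :=
    AddMonoidHom.range_eq_top.mpr (ratPointsEquivInvariants W).surjective
  rw [ratPointMap, AddMonoidHom.range_comp, AddMonoidHom.range_comp, htop,
    ← AddMonoidHom.range_eq_map]
  rfl

/-- **`E'(K̄)^{Γ_K}/φ(E(K̄)^{Γ_K}) ≃+ E'(K)/φ_K(E(K))`**. [folklore] -/
def quotInvariantsEquiv (φ : Isogeny W W') :
    invariants (Field.absoluteGaloisGroup K) W'.geomPoints ⧸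
        qInvariants (Field.absoluteGaloisGroup K) (q := φ.toAddMonoidHom) (isogeny_smul φ) ≃+
      W'.toAffine.Point ⧸ (ratPointMap φ).range :=
  QuotientAddGroup.congr _ _ (ratPointsEquivInvariants W').symm (map_qInvariants_eq_range_ratPointMap φ)

/-- Counting form: `#(E'(K̄)^Γ/φ(E(K̄)^Γ)) = #(E'(K)/φ_K(E(K)))`. [folklore] -/
theorem natCard_quot_qInvariants_eq (φ : Isogeny W W') :
    Nat.card (invariants (Field.absoluteGaloisGroup K) W'.geomPoints ⧸
        qInvariants (Field.absoluteGaloisGroup K) (q := φ.toAddMonoidHom) (isogeny_smul φ)) =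
      Nat.card (W'.toAffine.Point ⧸ (ratPointMap φ).range) :=
  Nat.card_congr (quotInvariantsEquiv φ).toEquiv

end RatPointMap

/-! ## §3. The fundamental sequence with `K`-rational data -/

section NumberField

variable [NumberField K] {W W' : WeierstrassCurve K} [W.IsElliptic] [W'.IsElliptic]

/-- **`#Sel^{(φ)}(E/K) = #(E'(K)/φ_K(E(K))) · #Ш(E/K)[φ]`** — Silverman X.4.2(a) in counting form
with the `K`-RATIONAL cokernel (gen 24's `natCard_isogenySelmerGroup_eq_mul_natCard_shaKer` +
Galois descent). [cite: SilvermanAEC2009, X.4.2(a)] -/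
theorem natCard_isogenySelmerGroup_eq_mul_natCard_shaKer_rat (φ : Isogeny W W') :
    Nat.card (isogenySelmerGroup φ) =
      Nat.card (W'.toAffine.Point ⧸ (ratPointMap φ).range) * Nat.card (shaKer φ) := by
  rw [natCard_isogenySelmerGroup_eq_mul_natCard_shaKer, natCard_quot_qInvariants_eq]

/-- **Lower certificate with `K`-rational data**: `#Sel^{(φ)}(E/K) = p^s` and
`#(E'(K)/φ_K(E(K))) = p^t` give `p^{s−t} ∣ #Ш(E/K)` (gen 24's
`pow_dvd_shaOrder_of_card_isogenySelmerGroup`, descended). [cite: SilvermanAEC2009, X.4.1–4.2] -/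
theorem pow_dvd_shaOrder_of_card_isogenySelmerGroup_rat (φ : Isogeny W W') {p s t : ℕ}
    (hp : p.Prime) (hS : Nat.card (isogenySelmerGroup φ) = p ^ s)
    (hQ : Nat.card (W'.toAffine.Point ⧸ (ratPointMap φ).range) = p ^ t) :
    p ^ (s - t) ∣ W.shaOrder :=
  pow_dvd_shaOrder_of_card_isogenySelmerGroup φ hp hS (by rw [natCard_quot_qInvariants_eq]; exact hQ)

/-- **Upper certificate with `K`-rational data (no excess)**: `#Sel^{(φ)}(E/K) = #(E'(K)/φ_K(E(K)))`
(finite, non-zero) forces `Ш(E/K)[φ]` to be trivial — the reading of a `φ`-descent "with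
`Sel^{(φ)} = E'(K)/φ(E(K))`" (x1b's rank-one `3`-descent certificates). [cite: SilvermanAEC2009, X.4.2(a)] -/
theorem natCard_shaKer_eq_one_of_card_eq_rat (φ : Isogeny W W')
    (h : Nat.card (isogenySelmerGroup φ) = Nat.card (W'.toAffine.Point ⧸ (ratPointMap φ).range))
    (h0 : Nat.card (isogenySelmerGroup φ) ≠ 0) : Nat.card (shaKer φ) = 1 :=
  natCard_shaKer_eq_one_of_card_eq φ (by rw [natCard_quot_qInvariants_eq]; exact h) h0

end NumberField

end Summit.BirchSwinnertonDyer.Rank1Residual.X2.IsogenySelmerRational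

end
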